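import Summits.QuantumFields.YangMills.Theorems.BalabanUVNodesN15TwoSpacingGluingCovariant
import Summits.QuantumFields.YangMills.Theorems.BalabanUVNodesN15TwoSpacingGluingAdjoint
import HarnessLib

/-!
# THE GLUING STEP AT TWO LATTICE SPACINGS, XI: the COVARIANT ADJOINT arrangement — `G∘[Δ_R + W, M_h]` for Bałaban's covariant Laplacian (3.50) and a scalar partition function, EXACTLY
# `G∘[W, M_h] − Σ_μ [(G∘D⁺_μ)∘M_{(∇_μh)∘τ_μ⁻¹} + (G∘D⁻_μ)∘M_{(∇*_μh)∘τ_μ} + G∘M_{∇*_μ∇_μh}]` (arbitrary transports), its (2.134) letter from the cube's RIGHT covariant entries `G∘D^±_μ`, and the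
# η-defect of that letter along any restriction map of the product carriers (dag-n15-c g11, FILE 53; N15 = NE2, s1 «background-layer OPERATOR ingredient»; covariant twin of FILE 49 §3)

Cell `pub-ymgap`, seat `pub-ymgap-dag-n15-c` (R134 (a); HUMAN RULING D-0062), generation 11.  `bears_on: R4∕N15 · K3⁷ SpineGivenEndpointR13SepCoPH (stmt-QuantumFields-20544)`.
Filed `--supports stmt-QuantumFields-20544 --as helper` — COUNT-NEUTRAL.  Theorems only (0 `def`, 0 `sorry`).  Imports BY NAME FILE 52 `…N15TwoSpacingGluingCovariant` (`mulOp_scalar_comp_covD`,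
`commOp_covLapM_scalar`, g10 `covLapM`, n15-b `covD`) and FILE 49 `…N15TwoSpacingGluingAdjoint` (`hasMaj_comp_mulOp_loc`, `remainderL`, FILE 45's `hasMaj_comp_diag`, `hasMaj_fsum`,
`idef_fsum`); nothing in the tree is modified.

WHY.  FILE 44's adjoint glued inverse `(1 − R̃)⁻¹G₀` (entry 2 of (3.42), `G∇*`) consumes the letters of the ADJOINT remainder `R̃ = Σ_□ M_{h_□}G_□[Δ, M_{h_□}]` (FILE 49 `remainderL`,
`hasMaj_remainderL`, `hasMaj_idef_remainderL` — rows `G_□∘[Δ, M_{h_□}]` and their defects).  FILE 49 §3 supplied those rows for the FLAT `∇*∇`; THIS FILE supplies them for the covariant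
`Δ_R + W`: moving the scalar coefficients of FILE 52's `[Δ_R, M_h] = Σ_μ[M_{∇*∇h} − M_{∇h}∘D⁺ − M_{∇*h}∘D⁻]` to the RIGHT of the covariant derivatives with FILE 52's right Leibniz form
`M_a∘D_e = D_e∘M_{a∘e⁻¹} + M_{∇*_e a}` (the transports commute with scalars), the two `M_{∇*∇h}` produced CANCEL the zeroth-order term up to sign: ★ `comp_commOp_covLapM` —
`G∘[Δ_R + W, M_h] = G∘[W, M_h] − Σ_μ[(G∘D⁺_μ)∘M_{(∇_μh)∘τ_μ⁻¹} + (G∘D⁻_μ)∘M_{(∇*_μh)∘τ_μ} + G∘M_{∇*_μ∇_μh}]` (EXACT, every `η`, arbitrary `R`; `∇_μ∇*_μ = ∇*_μ∇_μ`: `fgrad_fgradAdj_comm`); hence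
★★ `hasMaj_comp_commOp_covLapM` — `G∘[Δ_R + W, M_h] ≤ 1_S1_S·(|J|(2β₁c₁ + βc₂) + θ_W)e^{−δd}` from the cube's RIGHT covariant entries `G∘D^±_μ ≤ 1_S1_Sβ₁e^{−δd}`, `G ≤ 1_S1_Sβe^{−δd}` and the
SAME three partition letters as FILE 52 (`|∇h|, |∇*h| ≤ c₁`, `|∇*∇h| ≤ c₂` — one second difference, against FILE 49's three); ★ `hasMaj_idef_comp_mulOp_loc` (one term
`𝔇(T′M_{a′}, TM_a) = T′𝔇(M_{a′},M_a) + 𝔇(T′,T)M_a`) and ★★ `hasMaj_idef_comp_commOp_covLapM` — the η-defect row `𝔇(G′∘[Δ′_{R′} + W′, M_{h′}], G∘[Δ_R + W, M_h]) ≤ 1_S1_S·(|J|(2(β₁o₁ + m₁c₁)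
+ βo₂ + m₀c₂) + r_W)e^{−δd}` from the fine right entries, the coarse partition letters, the coefficient fits along `ϖ` and the right-entry defects = FILE 49 `hasMaj_idef_remainderL`'s `hDK`.

HONEST FRAMING ∕ LIMITS.  Lattice algebra + diagonal block-majorant bookkeeping ([B9] (3.42) p.397, (3.50)–(3.52) p.400, p.399; [B6] (2.91)–(2.92) p.239, (2.133)–(2.136) p.247 = SHAPES ∕
MECHANISM, transposed; nothing asserted).  The covariant right entries, their defects and the `W`-rows stay displayed.  NE2⁺ NOT PRINTED, NOT proved; N15 NOT discharged; counts of
record UNMOVED (typed 28∕28 · discharged 5∕27); one finite 𝕋⁴ at fixed ε — NOT infinite volume, NOT OS on ℝ⁴, NOT a mass gap, NOT Clay; R4 closes the conditional finite-𝕋⁴ rung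
`BalabanLadder.UV` only.  Restate-immune (no Theses import).
-/

noncomputable section

namespace Summit.QuantumFields.YangMills.BalabanUVNodes.N15.Gluing

open Literature.MathematicalPhysics.QuantumFieldTheory.Balaban1983to89
open Literature.MathematicalPhysics.QuantumFieldTheory.Balaban1983to89.B11SectG (BlockNorm HasMaj)
open Literature.MathematicalPhysics.QuantumFieldTheory.Balaban1983to89.T4EtaRateDefect (idef idef_sub idef_add idef_comp)
open Literature.MathematicalPhysics.QuantumFieldTheory.Balaban1983to89.T4EtaRateCoeffDefect (pull diagK hasMaj_mulOp hasMaj_idef_mulOp)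
open Literature.MathematicalPhysics.QuantumFieldTheory.Balaban1983to89.B6Prop26Gluing (mulOp mulOp_apply ind ind_nonneg)
open Summit.QuantumFields.YangMills.BalabanUVNodes.N15.BackgroundLayer (fgrad fgradAdj fgrad_apply fgradAdj_apply covLapM linearMap_comp_sum)
open Summit.QuantumFields.YangMills.BalabanUVNodes.N15.MatrixSpecies (covD)

/-! ## §1 Two facts of the one-step lattice calculus -/

section Calculus

variable {X : Type}

/-- `∇_e∇*_e = ∇*_e∇_e` (both are `n²(2a − a∘e − a∘e⁻¹)`). [cite: Balaban1984PropagatorsI, (1.2)–(1.3) p.18 (lattice derivatives: shape)] -/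
theorem fgrad_fgradAdj_comm (n : ℝ) (e : X ≃ X) (a : X → ℝ) : fgrad n e (fgradAdj n e a) = fgradAdj n e (fgrad n e a) := by
  funext x
  simp only [fgrad_apply, fgradAdj_apply, Equiv.symm_apply_apply, Equiv.apply_symm_apply]
  ring

/-- `∇*_{e⁻¹} = ∇_e`. [folklore] -/
theorem fgradAdj_symm (n : ℝ) (e : X ≃ X) : fgradAdj n e.symm = fgrad n e := by
  refine LinearMap.ext fun a => funext fun x => ?_
  simp only [fgrad_apply, fgradAdj_apply, Equiv.symm_symm]

end Calculus

/-! ## §2 The adjoint commutator piece of a covariant `Δ_R + W`: only the cube's RIGHT covariant entries appear -/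

section Adjoint

variable {X J ι : Type} [Fintype X] [Fintype J] [Fintype ι] [DecidableEq ι] {g : B6.Geometry} (blk : X × ι → g.Site)

omit [Fintype X] in
/-- ★ **THE ADJOINT COMMUTATOR PIECE, covariant `Δ_R + W`**: `G∘[Δ_R + W, M_h] = G∘[W, M_h] − Σ_μ [(G∘D⁺_μ)∘M_{(∇_μh)∘τ_μ⁻¹} + (G∘D⁻_μ)∘M_{(∇*_μh)∘τ_μ} + G∘M_{∇*_μ∇_μh}]` — EXACT for arbitrary
transports and every `η`; only the cube's RIGHT covariant entries `G`, `G∘D⁺_μ`, `G∘D⁻_μ` and the `W`-part appear. [cite: Balaban1984PropagatorsII, (2.91)–(2.92) p.239 (mechanism, transposed); Balaban1985BackgroundPropagators, (3.50) p.400] -/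
theorem comp_commOp_covLapM (τ : J → X ≃ X) (η : ℝ) (R : J ⊕ J → X → Matrix ι ι ℝ) (W G : (X × ι → ℝ) →ₗ[ℝ] (X × ι → ℝ)) (h : X → ℝ) :
    G ∘ₗ commOp (covLapM τ η R + W) (fun p : X × ι => h p.1) =
      G ∘ₗ commOp W (fun p : X × ι => h p.1) -
        ∑ μ, ((G ∘ₗ covD η (R (Sum.inl μ)) (τ μ)) ∘ₗ mulOp (fun p : X × ι => fgrad η⁻¹ (τ μ) h ((τ μ).symm p.1)) +
          (G ∘ₗ covD η (R (Sum.inr μ)) (τ μ).symm) ∘ₗ mulOp (fun p : X × ι => fgradAdj η⁻¹ (τ μ) h (τ μ p.1)) +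
          G ∘ₗ mulOp (fun p : X × ι => fgradAdj η⁻¹ (τ μ) (fgrad η⁻¹ (τ μ) h) p.1)) := by
  rw [commOp_add_left, LinearMap.comp_add, commOp_covLapM_scalar, linearMap_comp_sum, add_comm, sub_eq_add_neg, ← Finset.sum_neg_distrib]
  congr 1
  refine Finset.sum_congr rfl fun μ _ => ?_
  rw [mulOp_scalar_comp_covD, mulOp_scalar_comp_covD, Equiv.symm_symm, fgradAdj_symm, fgrad_fgradAdj_comm]
  simp only [LinearMap.comp_sub, LinearMap.comp_add, ← LinearMap.comp_assoc]
  abel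

/-- ★★ **THE ADJOINT (2.134) LETTER FROM THE CUBE'S RIGHT COVARIANT ENTRIES**: `G ≤ 1_S1_S·βe^{−δd}`, `G∘D⁺_μ, G∘D⁻_μ ≤ 1_S1_S·β₁e^{−δd}`, the partition's `|∇_μh|, |∇*_μh| ≤ c₁`,
`|∇*_μ∇_μh| ≤ c₂` and the `W`-row `G∘[W, M_h] ≤ 1_S1_S·θ_We^{−δd}` ⟹ `G∘[Δ_R + W, M_h] ≤ 1_S1_S·(|J|(2β₁c₁ + βc₂) + θ_W)·e^{−δd}` — FILE 49 `hasMaj_remainderL`'s row `hKc` for a covariant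
`Δ_R + W`, arbitrary transports. [cite: Balaban1984PropagatorsII, (2.133)–(2.134) p.247 (shapes + mechanism, transposed)] -/
theorem hasMaj_comp_commOp_covLapM {τ : J → X ≃ X} {η : ℝ} {R : J ⊕ J → X → Matrix ι ι ℝ} {W G : (X × ι → ℝ) →ₗ[ℝ] (X × ι → ℝ)} {h : X → ℝ} {S : Set g.Site}
    {β β₁ c₁ c₂ θW δ : ℝ} (hβ : 0 ≤ β) (hβ₁ : 0 ≤ β₁) (hc₁ : 0 ≤ c₁) (hc₂ : 0 ≤ c₂)
    (hh1 : ∀ μ x, |fgrad η⁻¹ (τ μ) h x| ≤ c₁) (hh1b : ∀ μ x, |fgradAdj η⁻¹ (τ μ) h x| ≤ c₁) (hh2 : ∀ μ x, |fgradAdj η⁻¹ (τ μ) (fgrad η⁻¹ (τ μ) h) x| ≤ c₂)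
    (hG : HasMaj (BlockNorm.ofBlocks g blk) (BlockNorm.ofBlocks g blk) G (fun y y' => ind S y * ind S y' * (β * Real.exp (-(δ * g.dist y y')))))
    (hD : ∀ μ, HasMaj (BlockNorm.ofBlocks g blk) (BlockNorm.ofBlocks g blk) (G ∘ₗ covD η (R (Sum.inl μ)) (τ μ))
      (fun y y' => ind S y * ind S y' * (β₁ * Real.exp (-(δ * g.dist y y')))))
    (hDb : ∀ μ, HasMaj (BlockNorm.ofBlocks g blk) (BlockNorm.ofBlocks g blk) (G ∘ₗ covD η (R (Sum.inr μ)) (τ μ).symm)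
      (fun y y' => ind S y * ind S y' * (β₁ * Real.exp (-(δ * g.dist y y')))))
    (hW : HasMaj (BlockNorm.ofBlocks g blk) (BlockNorm.ofBlocks g blk) (G ∘ₗ commOp W (fun p : X × ι => h p.1)) (fun y y' => ind S y * ind S y' * (θW * Real.exp (-(δ * g.dist y y'))))) :
    HasMaj (BlockNorm.ofBlocks g blk) (BlockNorm.ofBlocks g blk) (G ∘ₗ commOp (covLapM τ η R + W) (fun p : X × ι => h p.1))
      (fun y y' => ind S y * ind S y' * ((Fintype.card J * (2 * (β₁ * c₁) + β * c₂) + θW) * Real.exp (-(δ * g.dist y y')))) := by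
  have hterm : ∀ μ, HasMaj (BlockNorm.ofBlocks g blk) (BlockNorm.ofBlocks g blk)
      ((G ∘ₗ covD η (R (Sum.inl μ)) (τ μ)) ∘ₗ mulOp (fun p : X × ι => fgrad η⁻¹ (τ μ) h ((τ μ).symm p.1)) +
          (G ∘ₗ covD η (R (Sum.inr μ)) (τ μ).symm) ∘ₗ mulOp (fun p : X × ι => fgradAdj η⁻¹ (τ μ) h (τ μ p.1)) +
        G ∘ₗ mulOp (fun p : X × ι => fgradAdj η⁻¹ (τ μ) (fgrad η⁻¹ (τ μ) h) p.1))
      (fun y y' => ind S y * ind S y' * ((2 * (β₁ * c₁) + β * c₂) * Real.exp (-(δ * g.dist y y')))) := fun μ => by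
    have t1 := hasMaj_comp_mulOp_loc blk (a := fun p : X × ι => fgrad η⁻¹ (τ μ) h ((τ μ).symm p.1)) hβ₁ hc₁ (fun p => hh1 μ _) (hD μ)
    have t2 := hasMaj_comp_mulOp_loc blk (a := fun p : X × ι => fgradAdj η⁻¹ (τ μ) h (τ μ p.1)) hβ₁ hc₁ (fun p => hh1b μ _) (hDb μ)
    have t0 := hasMaj_comp_mulOp_loc blk (a := fun p : X × ι => fgradAdj η⁻¹ (τ μ) (fgrad η⁻¹ (τ μ) h) p.1) hβ hc₂ (fun p => hh2 μ _) hG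
    refine ((t1.add t2).add t0).mono fun y y' => le_of_eq ?_
    ring
  have hsum := hasMaj_fsum (b₁ := BlockNorm.ofBlocks g blk) (b₃ := BlockNorm.ofBlocks g blk) Finset.univ _ _ fun μ _ => hterm μ
  rw [comp_commOp_covLapM]
  refine (hW.sub hsum).mono fun y y' => le_of_eq ?_
  simp only [Finset.sum_const, Finset.card_univ, nsmul_eq_mul]
  ring

end Adjoint

/-! ## §3 The η-defect row of the adjoint letter -/

section AdjointDefect

variable {Y Y' : Type} [Fintype Y] [Fintype Y'] {g : B6.Geometry} (blk : Y → g.Site) (ϖ : Y' → Y)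

/-- ★ One term, coefficient on the RIGHT: `𝔇(T′∘M_{a′}, T∘M_a) = T′∘𝔇(M_{a′}, M_a) + 𝔇(T′, T)∘M_a ≤ 1_S1_S·(β·o + m·c)e^{−δd}` from the FINE letter `T′ ≤ 1_S1_S·βe^{−δd}`, the defect
`𝔇(T′, T) ≤ 1_S1_S·me^{−δd}`, the COARSE coefficient bound `|a| ≤ c` and the fit `|a′ − a∘ϖ| ≤ o`. [folklore] -/
theorem hasMaj_idef_comp_mulOp_loc {a : Y → ℝ} {a' : Y' → ℝ} {T : (Y → ℝ) →ₗ[ℝ] (Y → ℝ)} {T' : (Y' → ℝ) →ₗ[ℝ] (Y' → ℝ)} {S : Set g.Site} {c o β m δ : ℝ}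
    (hβ : 0 ≤ β) (hm : 0 ≤ m) (hc : 0 ≤ c) (ho : 0 ≤ o) (ha : ∀ y, |a y| ≤ c) (hfit : ∀ y', |a' y' - a (ϖ y')| ≤ o)
    (hT' : HasMaj (BlockNorm.ofBlocks g (blk ∘ ϖ)) (BlockNorm.ofBlocks g (blk ∘ ϖ)) T' (fun y y' => ind S y * ind S y' * (β * Real.exp (-(δ * g.dist y y')))))
    (hDT : HasMaj (BlockNorm.ofBlocks g blk) (BlockNorm.ofBlocks g (blk ∘ ϖ)) (idef (pull ϖ) (pull ϖ) T' T)
      (fun y y' => ind S y * ind S y' * (m * Real.exp (-(δ * g.dist y y'))))) :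
    HasMaj (BlockNorm.ofBlocks g blk) (BlockNorm.ofBlocks g (blk ∘ ϖ)) (idef (pull ϖ) (pull ϖ) (T' ∘ₗ mulOp a') (T ∘ₗ mulOp a))
      (fun y y' => ind S y * ind S y' * ((β * o + m * c) * Real.exp (-(δ * g.dist y y')))) := by
  have hMa := hasMaj_mulOp (g := g) blk (m := fun _ => c) (fun _ => hc) ha
  have hDM := hasMaj_idef_mulOp (g := g) blk ϖ (o := fun _ => o) (fun _ => ho) hfit
  have hnn : ∀ {k : ℝ}, 0 ≤ k → ∀ y y' : g.Site, 0 ≤ ind S y * ind S y' * (k * Real.exp (-(δ * g.dist y y'))) :=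
    fun hk y y' => mul_nonneg (mul_nonneg (ind_nonneg _ _) (ind_nonneg _ _)) (mul_nonneg hk (Real.exp_nonneg _))
  have t1 := hasMaj_comp_diag (blk ∘ ϖ) (hnn hβ) hT' hDM
  have t2 := hasMaj_comp_diag blk (hnn hm) hDT hMa
  rw [idef_comp (pull ϖ) (pull ϖ) (pull ϖ)]
  refine (t1.add t2).mono fun y y' => le_of_eq ?_
  ring

end AdjointDefect

section AdjointDefectLetter

variable {X X' J ι : Type} [Fintype X] [Fintype X'] [Fintype J] [Fintype ι] [DecidableEq ι] {g : B6.Geometry} (blk : X × ι → g.Site) (ϖ : X' × ι → X × ι)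

/-- ★★ **THE η-DEFECT ROW OF THE ADJOINT COVARIANT LETTER** (FILE 49 `hasMaj_idef_remainderL`'s `hDK` for a covariant `Δ_R + W`): fine right entries `G′ ≤ 1_S1_S·βe^{−δd}`,
`G′∘D′^±_μ ≤ 1_S1_S·β₁e^{−δd}`, COARSE partition letters `|∇h|, |∇*h| ≤ c₁`, `|∇*∇h| ≤ c₂`, fits along `ϖ` of the shifted coefficients `(∇h)∘τ⁻¹`, `(∇*h)∘τ` (`≤ o₁`) and of `∇*∇h`
(`≤ o₂`), right-entry defects `𝔇(G′, G) ≤ 1_S1_S·m₀e^{−δd}`, `𝔇(G′∘D′^±, G∘D^±) ≤ 1_S1_S·m₁e^{−δd}` (transports `R, R′` arbitrary) and the `W`-row defect `r_W`: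
`𝔇(G′∘[Δ′_{R′} + W′, M_{h′}], G∘[Δ_R + W, M_h]) ≤ 1_S1_S·(|J|(2(β₁o₁ + m₁c₁) + (βo₂ + m₀c₂)) + r_W)·e^{−δd}`.
[cite: Balaban1984PropagatorsII, (2.133)–(2.134) p.247 (shapes, transposed); Balaban1985BackgroundPropagators, Thm 3.14 pp.426–427 (difference template)] -/
theorem hasMaj_idef_comp_commOp_covLapM {τ : J → X ≃ X} {τ' : J → X' ≃ X'} {η η' : ℝ} {R : J ⊕ J → X → Matrix ι ι ℝ} {R' : J ⊕ J → X' → Matrix ι ι ℝ}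
    {W G : (X × ι → ℝ) →ₗ[ℝ] (X × ι → ℝ)} {W' G' : (X' × ι → ℝ) →ₗ[ℝ] (X' × ι → ℝ)} {h : X → ℝ} {h' : X' → ℝ} {S : Set g.Site} {β β₁ c₁ c₂ o₁ o₂ m₀ m₁ rW δ : ℝ}
    (hβ : 0 ≤ β) (hβ₁ : 0 ≤ β₁) (hm₀ : 0 ≤ m₀) (hm₁ : 0 ≤ m₁) (hc₁ : 0 ≤ c₁) (hc₂ : 0 ≤ c₂) (ho₁ : 0 ≤ o₁) (ho₂ : 0 ≤ o₂)
    (hh1 : ∀ μ x, |fgrad η⁻¹ (τ μ) h x| ≤ c₁) (hh1b : ∀ μ x, |fgradAdj η⁻¹ (τ μ) h x| ≤ c₁) (hh2 : ∀ μ x, |fgradAdj η⁻¹ (τ μ) (fgrad η⁻¹ (τ μ) h) x| ≤ c₂)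
    (hf1 : ∀ μ p', |fgrad η'⁻¹ (τ' μ) h' ((τ' μ).symm p'.1) - fgrad η⁻¹ (τ μ) h ((τ μ).symm (ϖ p').1)| ≤ o₁)
    (hf1b : ∀ μ p', |fgradAdj η'⁻¹ (τ' μ) h' (τ' μ p'.1) - fgradAdj η⁻¹ (τ μ) h (τ μ (ϖ p').1)| ≤ o₁)
    (hf2 : ∀ μ p', |fgradAdj η'⁻¹ (τ' μ) (fgrad η'⁻¹ (τ' μ) h') p'.1 - fgradAdj η⁻¹ (τ μ) (fgrad η⁻¹ (τ μ) h) (ϖ p').1| ≤ o₂)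
    (hG' : HasMaj (BlockNorm.ofBlocks g (blk ∘ ϖ)) (BlockNorm.ofBlocks g (blk ∘ ϖ)) G' (fun y y' => ind S y * ind S y' * (β * Real.exp (-(δ * g.dist y y')))))
    (hD' : ∀ μ, HasMaj (BlockNorm.ofBlocks g (blk ∘ ϖ)) (BlockNorm.ofBlocks g (blk ∘ ϖ)) (G' ∘ₗ covD η' (R' (Sum.inl μ)) (τ' μ))
      (fun y y' => ind S y * ind S y' * (β₁ * Real.exp (-(δ * g.dist y y')))))
    (hDb' : ∀ μ, HasMaj (BlockNorm.ofBlocks g (blk ∘ ϖ)) (BlockNorm.ofBlocks g (blk ∘ ϖ)) (G' ∘ₗ covD η' (R' (Sum.inr μ)) (τ' μ).symm)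
      (fun y y' => ind S y * ind S y' * (β₁ * Real.exp (-(δ * g.dist y y')))))
    (hDG : HasMaj (BlockNorm.ofBlocks g blk) (BlockNorm.ofBlocks g (blk ∘ ϖ)) (idef (pull ϖ) (pull ϖ) G' G) (fun y y' => ind S y * ind S y' * (m₀ * Real.exp (-(δ * g.dist y y')))))
    (hDD : ∀ μ, HasMaj (BlockNorm.ofBlocks g blk) (BlockNorm.ofBlocks g (blk ∘ ϖ)) (idef (pull ϖ) (pull ϖ) (G' ∘ₗ covD η' (R' (Sum.inl μ)) (τ' μ)) (G ∘ₗ covD η (R (Sum.inl μ)) (τ μ)))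
      (fun y y' => ind S y * ind S y' * (m₁ * Real.exp (-(δ * g.dist y y')))))
    (hDDb : ∀ μ, HasMaj (BlockNorm.ofBlocks g blk) (BlockNorm.ofBlocks g (blk ∘ ϖ))
      (idef (pull ϖ) (pull ϖ) (G' ∘ₗ covD η' (R' (Sum.inr μ)) (τ' μ).symm) (G ∘ₗ covD η (R (Sum.inr μ)) (τ μ).symm))
      (fun y y' => ind S y * ind S y' * (m₁ * Real.exp (-(δ * g.dist y y')))))
    (hDW : HasMaj (BlockNorm.ofBlocks g blk) (BlockNorm.ofBlocks g (blk ∘ ϖ))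
      (idef (pull ϖ) (pull ϖ) (G' ∘ₗ commOp W' (fun p' : X' × ι => h' p'.1)) (G ∘ₗ commOp W (fun p : X × ι => h p.1)))
      (fun y y' => ind S y * ind S y' * (rW * Real.exp (-(δ * g.dist y y'))))) :
    HasMaj (BlockNorm.ofBlocks g blk) (BlockNorm.ofBlocks g (blk ∘ ϖ))
      (idef (pull ϖ) (pull ϖ) (G' ∘ₗ commOp (covLapM τ' η' R' + W') (fun p' : X' × ι => h' p'.1)) (G ∘ₗ commOp (covLapM τ η R + W) (fun p : X × ι => h p.1)))
      (fun y y' => ind S y * ind S y' * ((Fintype.card J * (2 * (β₁ * o₁ + m₁ * c₁) + (β * o₂ + m₀ * c₂)) + rW) * Real.exp (-(δ * g.dist y y')))) := by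
  have hterm : ∀ μ, HasMaj (BlockNorm.ofBlocks g blk) (BlockNorm.ofBlocks g (blk ∘ ϖ))
      (idef (pull ϖ) (pull ϖ)
        ((G' ∘ₗ covD η' (R' (Sum.inl μ)) (τ' μ)) ∘ₗ mulOp (fun p' : X' × ι => fgrad η'⁻¹ (τ' μ) h' ((τ' μ).symm p'.1)) +
            (G' ∘ₗ covD η' (R' (Sum.inr μ)) (τ' μ).symm) ∘ₗ mulOp (fun p' : X' × ι => fgradAdj η'⁻¹ (τ' μ) h' (τ' μ p'.1)) +
          G' ∘ₗ mulOp (fun p' : X' × ι => fgradAdj η'⁻¹ (τ' μ) (fgrad η'⁻¹ (τ' μ) h') p'.1))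
        ((G ∘ₗ covD η (R (Sum.inl μ)) (τ μ)) ∘ₗ mulOp (fun p : X × ι => fgrad η⁻¹ (τ μ) h ((τ μ).symm p.1)) +
            (G ∘ₗ covD η (R (Sum.inr μ)) (τ μ).symm) ∘ₗ mulOp (fun p : X × ι => fgradAdj η⁻¹ (τ μ) h (τ μ p.1)) +
          G ∘ₗ mulOp (fun p : X × ι => fgradAdj η⁻¹ (τ μ) (fgrad η⁻¹ (τ μ) h) p.1)))
      (fun y y' => ind S y * ind S y' * ((2 * (β₁ * o₁ + m₁ * c₁) + (β * o₂ + m₀ * c₂)) * Real.exp (-(δ * g.dist y y')))) := fun μ => by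
    have t1 := hasMaj_idef_comp_mulOp_loc blk ϖ (a := fun p : X × ι => fgrad η⁻¹ (τ μ) h ((τ μ).symm p.1))
      (a' := fun p' : X' × ι => fgrad η'⁻¹ (τ' μ) h' ((τ' μ).symm p'.1)) hβ₁ hm₁ hc₁ ho₁ (fun p => hh1 μ _) (hf1 μ) (hD' μ) (hDD μ)
    have t2 := hasMaj_idef_comp_mulOp_loc blk ϖ (a := fun p : X × ι => fgradAdj η⁻¹ (τ μ) h (τ μ p.1))
      (a' := fun p' : X' × ι => fgradAdj η'⁻¹ (τ' μ) h' (τ' μ p'.1)) hβ₁ hm₁ hc₁ ho₁ (fun p => hh1b μ _) (hf1b μ) (hDb' μ) (hDDb μ)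
    have t0 := hasMaj_idef_comp_mulOp_loc blk ϖ (a := fun p : X × ι => fgradAdj η⁻¹ (τ μ) (fgrad η⁻¹ (τ μ) h) p.1)
      (a' := fun p' : X' × ι => fgradAdj η'⁻¹ (τ' μ) (fgrad η'⁻¹ (τ' μ) h') p'.1) hβ hm₀ hc₂ ho₂ (fun p => hh2 μ _) (hf2 μ) hG' hDG
    rw [idef_add, idef_add]
    refine ((t1.add t2).add t0).mono fun y y' => le_of_eq ?_
    ring
  have hsum := hasMaj_fsum (b₁ := BlockNorm.ofBlocks g blk) (b₃ := BlockNorm.ofBlocks g (blk ∘ ϖ)) Finset.univ _ _ fun μ _ => hterm μ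
  rw [comp_commOp_covLapM, comp_commOp_covLapM, idef_sub, idef_fsum]
  refine (hDW.sub hsum).mono fun y y' => le_of_eq ?_
  simp only [Finset.sum_const, Finset.card_univ, nsmul_eq_mul]
  ring

end AdjointDefectLetter

end Summit.QuantumFields.YangMills.BalabanUVNodes.N15.Gluing

end
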